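import Mathlib.Analysis.Calculus.ContDiff.Deriv
import Mathlib.Analysis.Calculus.MeanValue
import Mathlib.Analysis.MeanInequalitiesPow
import Mathlib.Analysis.PSeries
import Mathlib.Analysis.SpecificLimits.Basic
import Mathlib.Data.Nat.Choose.Bounds
import Mathlib.MeasureTheory.OuterMeasure.BorelCantelli
import Literature.MathematicalPhysics.KineticTheory.InfiniteChainUniqueness
import Literature.MathematicalPhysics.KineticTheory.InfiniteChainDynamicsWeakProofs
import HarnessLib

/-!
# Lanford–Lebowitz–Lieb 1977, Theorems 2 and 4 (uniqueness; a.e. dynamics in the growth class): proofs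

Topic `Literature/MathematicalPhysics/KineticTheory`; proofs-only companion of
`InfiniteChainUniqueness.lean`. It DISCHARGES the two named facts stated there,
`OscillatorChain.LanfordLebowitzLieb1977_thm2_chain` and
`OscillatorChain.LanfordLebowitzLieb1977_thm4_chain` (O. E. Lanford III, J. L. Lebowitz, E. H. Lieb,
*Time evolution of infinite anharmonic systems*, J. Stat. Phys. **16** (1977) 453–461, §3 Thm 2 with
the Example (13), pp. 457–459, and §4 Proposition and Thm 4, pp. 460–461), following the printed
proofs.

## Theorem 2 (pp. 457–458), as formalised

For two solutions `q⁽¹⁾, q⁽²⁾` with the same initial point put `Δq_i = q_i⁽¹⁾ - q_i⁽²⁾`. The print: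
"`δ_n(t) = sup{|q_i⁽¹⁾(t) - q_i⁽²⁾(t)| : |i| ≤ nD}` … we then get, using (12b),
`δ_n(t) ≤ [∫₀ᵗ dt₁ (t - t₁) δ_{n+1}(t₁)] c n²`. Iterating this `k` times, then using the bound
`δ_{n+k}(t) ≤ 2B̄_{(n+k)D}`, we obtain `δ_n(t) ≤ t^{2k}/(2k)! (2B̄_{(n+k)D}) cᵏ [n(n+1)⋯(n+k-1)]²`.
Thus, letting `k → ∞`, we find that `δ_n(t) = 0`" for `t` below a constant independent of `n`,
"which proves the theorem" (restarting on `[0, T]`). Here (chain, `D = 1`, `n = m + 1`, growth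
class `|q_j(t)| ≤ C(|j|^{1/m} + 1)` on `[0, τ]`, i.e. `B_j = C(|j|^{1/(n-1)} + 1)`):

* `abs_deriv_sub_le_of_abs_deriv_two_le`, `force_sub_le`: the Lipschitz bound (12b) in use — for
  `|i| ≤ n` and all `|q_j| ≤ C((n+1)^{1/m} + 1)`, `|j| ≤ n + 1`,
  `|F_i(q⁽¹⁾) - F_i(q⁽²⁾)| ≤ K (n+1)² sup_{|j| ≤ n+1} |Δq_j|`, `K = 5c₁(1 + 2C)^{2m}` (mean value
  theorem on `U'`, `V'` with (13): this is the Example's "`B_j = b|j|^{1/(n-1)}` is a sequence of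
  uniqueness");
* `abs_le_of_abs_deriv_two_le`: the elementary step `Δq_i(0) = Δq̇_i(0) = 0`,
  `|Δq̈_i(s)| ≤ A sʲ` ⇒ `|Δq̇_i(t)| ≤ A t^{j+1}/(j+1)`, `|Δq_i(t)| ≤ A t^{j+2}/((j+1)(j+2))` (the
  integral form (3) of the print, done with Mathlib's fencing theorem
  `image_norm_le_of_norm_deriv_right_le_deriv_boundary`);
* `iterate_bound`: the `k`-fold iteration, `|Δq_i(t)| ≤ Φ(n, k) t^{2k}` for `|i| ≤ n`, where
  `Φ(n, k) = A 2^{n+k} Kᵏ ((n+k)!)² / ((n!)² (2k)!)` is the printed coefficient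
  (`A 2^N = 4C 2^N ≥ 2C(N^{1/m} + 1) ≥ δ_N` is the bound "`δ_{n+k} ≤ 2B̄_{(n+k)D}`"; the lemma is
  stated for any supersolution `Φ` of the recursion `llCoef_zero`/`llCoef_succ`);
* `llCoef_le`: `((n+k)!)² ≤ 4^{n+k} (n!)² (2k)!`, so `Φ(n, k) t^{2k} ≤ A 8ⁿ (8Kt²)ᵏ → 0` for
  `8Kt² ≤ 1/2`: local uniqueness on `[0, t₀]`, `t₀ = 1/(4(K+1))` (`eqOn_small`), the momenta
  following as derivatives of the positions (`deriv_eqOn_of_eqOn`);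
* `eqOn_of_growth`: restarting at `t₀, 2t₀, …`, and `LanfordLebowitzLieb1977_thm2_chain_holds`.

## Theorem 4 (pp. 460–461), as formalised

* `ae_growth_of_moment` — the Proposition: (18) `∫ |q_i|^γ dμ ≤ C`, `γ > ν(n-1) = m` ⇒ (17)
  `sup_i |q_i|/(|i|^{1/m} + 1) < ∞` a.e. (Markov `μ(|q_i| > (|i|+1)^{1/m}) ≤ C(|i|+1)^{-γ/m}`,
  `∑_i (|i|+1)^{-γ/m} < ∞`, Borel–Cantelli as `MeasureTheory.ae_finite_setOf_mem`);
* `inGrowthClass_of_thm3_bound`: a Thm-3 solution ((15): `|q_i(t) - q_i| ≤ C(1+t²)[log₊ i]^{1/2}`)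
  issued from a point satisfying (17) lies in the growth class ("then
  `sup_{|t|≤τ} sup_i |q_i(t)|/|i|^{1/(n-1)}` is finite for all `τ`";
  `[log₊ i]^{1/2} ≤ m(|i|^{1/m} + 1)`);
* `IsSolution.timeRev`, `eq_of_inGrowthClass`: Theorem 2 forward in time plus the time reversal
  `(q, p)(t) ↦ (q, -p)(-t)` give uniqueness among global solutions in the class ("Theorem 2
  asserts that the solution is unique in this class");
* `LanfordLebowitzLieb1977_thm4_chain_holds`: assembly with
  `LanfordLebowitzLieb1977_thm3_chain_holds` ("Collecting the above results").

Everything here is proved; no named facts. [cite: LanfordLebowitzLieb1977, §3 Thm 2 and Example (13); §4 Proposition and Thm 4]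

## References

* O. E. Lanford III, J. L. Lebowitz, E. H. Lieb, *Time evolution of infinite anharmonic systems*,
  J. Stat. Phys. 16 (1977) 453–461, doi:10.1007/bf01152283, §3 Theorem 2 and Example (13),
  §4 Proposition and Theorem 4. [LanfordLebowitzLieb1977]
-/

noncomputable section

open MeasureTheory Filter Topology Set
open scoped ENNReal Nat

namespace Literature.MathematicalPhysics.KineticTheory.HeatConduction

namespace OscillatorChain

/-! ### Elementary calculus steps -/

/-- Mean value theorem for a `C²` function: if `|f''| ≤ ℓ` on `[-ρ, ρ]` then `f'` is `ℓ`-Lipschitz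
there. [folklore] -/
theorem abs_deriv_sub_le_of_abs_deriv_two_le {f : ℝ → ℝ} (hf : ContDiff ℝ 2 f) {ρ ℓ : ℝ}
    (hℓ : ∀ a, |a| ≤ ρ → |deriv (deriv f) a| ≤ ℓ) {x y : ℝ} (hx : |x| ≤ ρ) (hy : |y| ≤ ρ) :
    |deriv f x - deriv f y| ≤ ℓ * |x - y| := by
  have hd : Differentiable ℝ (deriv f) := hf.differentiable_deriv_two
  have key := (convex_Icc (-ρ) ρ).norm_image_sub_le_of_norm_deriv_le (f := deriv f) (C := ℓ)
    (𝕜 := ℝ) (fun a _ => (hd a)) (fun a ha => by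
      rw [Real.norm_eq_abs]; exact hℓ a (abs_le.2 ⟨ha.1, ha.2⟩)) (abs_le.1 hy) (abs_le.1 hx)
  simpa [Real.norm_eq_abs] using key

/-- The elementary integration step of LLL's iteration: if `g(0) = g'(0) = 0` and
`|g''(s)| ≤ A sʲ` on `[0, τ)`, then `|g'(t)| ≤ A t^{j+1}/(j+1)` and `|g(t)| ≤ A t^{j+2}/((j+1)(j+2))`
on `[0, τ]`. [cite: LanfordLebowitzLieb1977, §3 Thm 2, proof] -/
theorem abs_le_of_abs_deriv_two_le {g g' g'' : ℝ → ℝ} {τ A : ℝ} {j : ℕ}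
    (hg : ∀ t, HasDerivAt g (g' t) t) (hg' : ∀ t, HasDerivAt g' (g'' t) t)
    (h0 : g 0 = 0) (h0' : g' 0 = 0) (hb : ∀ s ∈ Ico 0 τ, |g'' s| ≤ A * s ^ j) :
    ∀ t ∈ Icc 0 τ, |g' t| ≤ A * t ^ (j + 1) / (j + 1) ∧
      |g t| ≤ A * t ^ (j + 2) / ((j + 1) * (j + 2)) := by
  have hj1 : (j + 1 : ℝ) ≠ 0 := by positivity
  have hj2 : (j + 2 : ℝ) ≠ 0 := by positivity
  -- the two bounding polynomials and their derivatives
  have hB₁ : ∀ x, HasDerivAt (fun s => A * s ^ (j + 1) / (j + 1)) (A * x ^ j) x := fun x => by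
    have h := ((hasDerivAt_pow (j + 1) x).const_mul A).div_const (j + 1 : ℝ)
    have e : A * (((j + 1 : ℕ) : ℝ) * x ^ (j + 1 - 1)) / (j + 1 : ℝ) = A * x ^ j := by
      rw [Nat.add_sub_cancel]; push_cast; field_simp
    rwa [e] at h
  have hB₂ : ∀ x, HasDerivAt (fun s => A * s ^ (j + 2) / ((j + 1) * (j + 2)))
      (A * x ^ (j + 1) / (j + 1)) x := fun x => by
    have h := ((hasDerivAt_pow (j + 2) x).const_mul A).div_const ((j + 1 : ℝ) * (j + 2))
    have e : A * (((j + 2 : ℕ) : ℝ) * x ^ (j + 2 - 1)) / ((j + 1 : ℝ) * (j + 2)) =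
        A * x ^ (j + 1) / (j + 1) := by
      rw [show j + 2 - 1 = j + 1 by omega]; push_cast; field_simp
    rwa [e] at h
  have step₁ : ∀ ⦃x⦄, x ∈ Icc 0 τ → ‖g' x‖ ≤ A * x ^ (j + 1) / (j + 1) :=
    image_norm_le_of_norm_deriv_right_le_deriv_boundary
      (fun x _ => (hg' x).continuousAt.continuousWithinAt)
      (fun x _ => (hg' x).hasDerivWithinAt) (by simp [h0']) hB₁
      (fun x hx => by rw [Real.norm_eq_abs]; exact hb x hx)
  have step₂ : ∀ ⦃x⦄, x ∈ Icc 0 τ → ‖g x‖ ≤ A * x ^ (j + 2) / ((j + 1) * (j + 2)) :=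
    image_norm_le_of_norm_deriv_right_le_deriv_boundary
      (fun x _ => (hg x).continuousAt.continuousWithinAt)
      (fun x _ => (hg x).hasDerivWithinAt) (by simp [h0]) hB₂
      (fun x hx => step₁ (Ico_subset_Icc_self hx))
  intro t ht
  exact ⟨by simpa [Real.norm_eq_abs] using step₁ ht, by simpa [Real.norm_eq_abs] using step₂ ht⟩

/-- If two differentiable functions agree on `[0, b]`, `b > 0`, so do their derivatives. [folklore] -/
theorem deriv_eqOn_of_eqOn {f₁ f₂ f₁' f₂' : ℝ → ℝ} {b : ℝ} (hb : 0 < b)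
    (h₁ : ∀ t, HasDerivAt f₁ (f₁' t) t) (h₂ : ∀ t, HasDerivAt f₂ (f₂' t) t)
    (heq : ∀ t ∈ Icc 0 b, f₁ t = f₂ t) : ∀ t ∈ Icc 0 b, f₁' t = f₂' t := by
  intro t ht
  have hu : UniqueDiffWithinAt ℝ (Icc 0 b) t := uniqueDiffOn_Icc hb t ht
  have e₁ : HasDerivWithinAt f₁ (f₁' t) (Icc 0 b) t := (h₁ t).hasDerivWithinAt
  have e₂ : HasDerivWithinAt f₁ (f₂' t) (Icc 0 b) t :=
    (h₂ t).hasDerivWithinAt.congr (fun x hx => heq x hx) (heq t ht)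
  exact hu.eq_deriv _ e₁ e₂

/-! ### The iteration (LLL 1977, proof of Theorem 2) -/

/-- The coefficient produced by `k` iterations of `δ_n ≤ K(n+1)² ∫∫ δ_{n+1}` started from
`δ_N ≤ A 2^N` is `Φ(n, k) = A 2^{n+k} Kᵏ ((n+k)!)² / ((n!)² (2k)!)` (the print's
`2B̄ cᵏ [n(n+1)⋯(n+k-1)]² / (2k)!`); at `k = 0` it is `A 2ⁿ`. [cite: LanfordLebowitzLieb1977, §3 Thm 2, proof] -/
theorem llCoef_zero (A K : ℝ) (n : ℕ) :
    A * 2 ^ (n + 0) * K ^ 0 * ((n + 0)! : ℝ) ^ 2 / ((n ! : ℝ) ^ 2 * ((2 * 0)! : ℝ)) = A * 2 ^ n := by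
  have h : (n ! : ℝ) ≠ 0 := by positivity
  simp only [add_zero, pow_zero, mul_one, mul_zero, Nat.factorial_zero, Nat.cast_one]
  field_simp

/-- The recursion `Φ(n, k+1) = K (n+1)² Φ(n+1, k) / ((2k+1)(2k+2))` of LLL's coefficients. [folklore] -/
theorem llCoef_succ (A K : ℝ) (n k : ℕ) :
    K * ((n : ℝ) + 1) ^ 2 *
        (A * 2 ^ (n + 1 + k) * K ^ k * ((n + 1 + k)! : ℝ) ^ 2 /
          (((n + 1)! : ℝ) ^ 2 * ((2 * k)! : ℝ))) / ((2 * k + 1) * (2 * k + 2)) =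
      A * 2 ^ (n + (k + 1)) * K ^ (k + 1) * ((n + (k + 1))! : ℝ) ^ 2 /
        ((n ! : ℝ) ^ 2 * ((2 * (k + 1))! : ℝ)) := by
  have hn : (n ! : ℝ) ≠ 0 := by positivity
  have h2k : ((2 * k)! : ℝ) ≠ 0 := by positivity
  have h1 : (2 * k + 1 : ℝ) ≠ 0 := by positivity
  have h2 : (2 * k + 2 : ℝ) ≠ 0 := by positivity
  have e1 : ((n + 1)! : ℝ) = (n + 1) * n ! := by push_cast [Nat.factorial_succ]; ring
  have e2 : ((2 * (k + 1))! : ℝ) = (2 * k + 2) * (2 * k + 1) * (2 * k)! := by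
    rw [show 2 * (k + 1) = (2 * k + 1) + 1 by ring, Nat.factorial_succ, Nat.factorial_succ]
    push_cast; ring
  have e3 : ((n + (k + 1))! : ℝ) = ((n + 1 + k)! : ℝ) := by rw [show n + (k + 1) = n + 1 + k by ring]
  rw [e1, e2, e3, show n + (k + 1) = n + 1 + k by ring]
  field_simp
  ring

/-- `((n+k)!)² ≤ 4^{n+k} (n!)² (2k)!` (from `(n+k)! = C(n+k,k) k! n!`, `C(n+k,k) ≤ 2^{n+k}` and
`(k!)² ≤ (2k)!`). [folklore] -/
theorem factorial_add_sq_le (n k : ℕ) :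
    ((n + k)! : ℝ) ^ 2 ≤ 4 ^ (n + k) * (n ! : ℝ) ^ 2 * ((2 * k)! : ℝ) := by
  have h1 : ((n + k)! : ℝ) = ((n + k).choose k : ℝ) * n ! * k ! := by
    exact_mod_cast (Nat.add_choose_mul_factorial_mul_factorial n k).symm
  have h2 : ((n + k).choose k : ℝ) ≤ 2 ^ (n + k) := by
    exact_mod_cast Nat.choose_le_two_pow (n + k) k
  have h3 : (k ! : ℝ) * k ! ≤ ((2 * k)! : ℝ) := by
    have h := Nat.add_choose_mul_factorial_mul_factorial k k
    have hpos : 1 ≤ (k + k).choose k := Nat.choose_pos (Nat.le_add_left k k)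
    have : k ! * k ! ≤ (k + k)! := by
      calc k ! * k ! = 1 * k ! * k ! := by ring
        _ ≤ (k + k).choose k * k ! * k ! := by gcongr
        _ = (k + k)! := h
    rw [two_mul]; exact_mod_cast this
  have h0 : (0 : ℝ) ≤ ((n + k).choose k : ℝ) := by positivity
  calc ((n + k)! : ℝ) ^ 2 = ((n + k).choose k : ℝ) ^ 2 * (n ! : ℝ) ^ 2 * (k ! * k !) := by
        rw [h1]; ring
    _ ≤ (2 ^ (n + k)) ^ 2 * (n ! : ℝ) ^ 2 * ((2 * k)! : ℝ) := by gcongr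
    _ = 4 ^ (n + k) * (n ! : ℝ) ^ 2 * ((2 * k)! : ℝ) := by
        rw [← pow_mul, mul_comm (n + k) 2, pow_mul]; norm_num

/-- The closed-form bound `Φ(n, k) ≤ A 8^{n+k} Kᵏ` on LLL's coefficients. [folklore] -/
theorem llCoef_le {A K : ℝ} (hA : 0 ≤ A) (hK : 0 ≤ K) (n k : ℕ) :
    A * 2 ^ (n + k) * K ^ k * ((n + k)! : ℝ) ^ 2 / ((n ! : ℝ) ^ 2 * ((2 * k)! : ℝ)) ≤
      A * 8 ^ (n + k) * K ^ k := by
  have hn : (0 : ℝ) < (n ! : ℝ) ^ 2 * ((2 * k)! : ℝ) := by positivity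
  rw [div_le_iff₀ hn]
  calc A * 2 ^ (n + k) * K ^ k * ((n + k)! : ℝ) ^ 2
      ≤ A * 2 ^ (n + k) * K ^ k * (4 ^ (n + k) * (n ! : ℝ) ^ 2 * ((2 * k)! : ℝ)) := by
        gcongr; exact factorial_add_sq_le n k
    _ = A * 8 ^ (n + k) * K ^ k * ((n ! : ℝ) ^ 2 * ((2 * k)! : ℝ)) := by
        rw [show (8 : ℝ) = 2 * 4 by norm_num, mul_pow]; ring

section Iteration

variable {P : OscillatorChain} {γ₁ γ₂ : ℝ → ChainConfig} {τ K A : ℝ}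

/-- **LLL's iteration (proof of Thm 2).** If the force differences obey the Lipschitz bound (12b),
`|F_i(q⁽¹⁾(t)) - F_i(q⁽²⁾(t))| ≤ K(n+1)² sup_{|j| ≤ n+1} |Δq_j(t)|` for `|i| ≤ n`, `t ∈ [0, τ]`,
and `Φ` is any supersolution of the recursion (`sup_{|j| ≤ n} |Δq_j| ≤ Φ(n, 0)` on `[0, τ]`,
`K(n+1)² Φ(n+1, k)/((2k+1)(2k+2)) ≤ Φ(n, k+1)`), then after `k` iterations
`|Δq_i(t)| ≤ Φ(n, k) t^{2k}` for `|i| ≤ n`, `t ∈ [0, τ]`. [cite: LanfordLebowitzLieb1977, §3 Thm 2, proof] -/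
theorem iterate_bound (h₁ : P.IsSolution γ₁) (h₂ : P.IsSolution γ₂) (h0 : γ₁ 0 = γ₂ 0)
    (hL : ∀ (n : ℕ) (i : ℤ), |i| ≤ (n : ℤ) → ∀ t ∈ Icc 0 τ, ∀ δ : ℝ,
      (∀ j : ℤ, |j| ≤ (n : ℤ) + 1 → |(γ₁ t j).1 - (γ₂ t j).1| ≤ δ) →
        |P.force (γ₁ t) i - P.force (γ₂ t) i| ≤ K * ((n : ℝ) + 1) ^ 2 * δ)
    {Φ : ℕ → ℕ → ℝ}
    (hΦ0 : ∀ (n : ℕ) (i : ℤ), |i| ≤ (n : ℤ) → ∀ t ∈ Icc 0 τ,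
      |(γ₁ t i).1 - (γ₂ t i).1| ≤ Φ n 0)
    (hΦs : ∀ n k : ℕ,
      K * ((n : ℝ) + 1) ^ 2 * Φ (n + 1) k / ((2 * k + 1) * (2 * k + 2)) ≤ Φ n (k + 1)) :
    ∀ (k n : ℕ) (i : ℤ), |i| ≤ (n : ℤ) → ∀ t ∈ Icc 0 τ,
      |(γ₁ t i).1 - (γ₂ t i).1| ≤ Φ n k * t ^ (2 * k) := by
  intro k
  induction k with
  | zero =>
    intro n i hi t ht
    simpa using hΦ0 n i hi t ht
  | succ k ih =>
    intro n i hi t ht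
    -- the step: `Δq_i'' = ΔF_i`, bounded by `K(n+1)² Φ(n+1, k) s^{2k}` on `[0, τ]`
    set A' : ℝ := K * ((n : ℝ) + 1) ^ 2 * Φ (n + 1) k with hA'
    have hg : ∀ s, HasDerivAt (fun s => (γ₁ s i).1 - (γ₂ s i).1) ((γ₁ s i).2 - (γ₂ s i).2) s :=
      fun s => (h₁ i s).1.sub (h₂ i s).1
    have hg' : ∀ s, HasDerivAt (fun s => (γ₁ s i).2 - (γ₂ s i).2)
        (P.force (γ₁ s) i - P.force (γ₂ s) i) s := fun s => (h₁ i s).2.sub (h₂ i s).2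
    have hq0 : (γ₁ 0 i).1 - (γ₂ 0 i).1 = 0 := by rw [h0]; ring
    have hp0 : (γ₁ 0 i).2 - (γ₂ 0 i).2 = 0 := by rw [h0]; ring
    have hb : ∀ s ∈ Ico 0 τ, |P.force (γ₁ s) i - P.force (γ₂ s) i| ≤ A' * s ^ (2 * k) := by
      intro s hs
      have hs' : s ∈ Icc 0 τ := Ico_subset_Icc_self hs
      have := hL n i hi s hs' (Φ (n + 1) k * s ^ (2 * k)) (fun j hj => by
        exact ih (n + 1) j (by push_cast; exact hj) s hs')
      calc |P.force (γ₁ s) i - P.force (γ₂ s) i|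
          ≤ K * ((n : ℝ) + 1) ^ 2 * (Φ (n + 1) k * s ^ (2 * k)) := this
        _ = A' * s ^ (2 * k) := by rw [hA']; ring
    have key := (abs_le_of_abs_deriv_two_le hg hg' hq0 hp0 hb t ht).2
    have ht0 : 0 ≤ t ^ (2 * k + 2) := pow_nonneg ht.1 _
    calc |(γ₁ t i).1 - (γ₂ t i).1| ≤ A' * t ^ (2 * k + 2) / ((↑(2 * k) + 1) * (↑(2 * k) + 2)) := key
      _ = K * ((n : ℝ) + 1) ^ 2 * Φ (n + 1) k / ((2 * k + 1) * (2 * k + 2)) * t ^ (2 * k + 2) := by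
          rw [hA']; push_cast; ring
      _ ≤ Φ n (k + 1) * t ^ (2 * k + 2) := mul_le_mul_of_nonneg_right (hΦs n k) ht0
      _ = Φ n (k + 1) * t ^ (2 * (k + 1)) := by ring_nf

end Iteration

/-! ### The Lipschitz bound (12b) from the growth hypothesis (13) -/

section Lipschitz

variable {P : OscillatorChain} {m : ℕ} {c₁ : ℝ}

/-- `V''` is bounded by `c₁(1+ρ)^{2m}` on `[-2ρ, 2ρ]` under (13). [cite: LanfordLebowitzLieb1977, §3 eq. (13)] -/
theorem abs_deriv_two_V_le (hgV : ∀ a b : ℝ, |deriv (deriv P.V) (b - a)| ≤ c₁ * (1 + max |a| |b|) ^ (2 * m))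
    (hc₁ : 0 ≤ c₁) {ρ : ℝ} (r : ℝ) (hr : |r| ≤ 2 * ρ) :
    |deriv (deriv P.V) r| ≤ c₁ * (1 + ρ) ^ (2 * m) := by
  have h := hgV (-(r / 2)) (r / 2)
  have e : r / 2 - -(r / 2) = r := by ring
  rw [e, abs_neg, max_self] at h
  refine h.trans ?_
  have : |r / 2| ≤ ρ := by rw [abs_div, abs_two]; linarith
  gcongr

/-- **(12b) for the chain.** If all positions at the sites `i-1, i, i+1` of two configurations are
bounded by `ρ` and differ by at most `δ`, then under (13)
`|F_i(q⁽¹⁾) - F_i(q⁽²⁾)| ≤ 5c₁(1+ρ)^{2m} δ`. [cite: LanfordLebowitzLieb1977, §3 eqs. (12b), (13)] -/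
theorem force_sub_le (hU : ContDiff ℝ 2 P.U) (hV : ContDiff ℝ 2 P.V) (hc₁ : 0 ≤ c₁)
    (hgU : ∀ a : ℝ, |deriv (deriv P.U) a| ≤ c₁ * (1 + |a|) ^ (2 * m))
    (hgV : ∀ a b : ℝ, |deriv (deriv P.V) (b - a)| ≤ c₁ * (1 + max |a| |b|) ^ (2 * m))
    {ρ δ : ℝ} {σ₁ σ₂ : ChainConfig} {i : ℤ}
    (hρ₁ : ∀ j, i - 1 ≤ j → j ≤ i + 1 → |(σ₁ j).1| ≤ ρ)
    (hρ₂ : ∀ j, i - 1 ≤ j → j ≤ i + 1 → |(σ₂ j).1| ≤ ρ)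
    (hδ : ∀ j, i - 1 ≤ j → j ≤ i + 1 → |(σ₁ j).1 - (σ₂ j).1| ≤ δ) :
    |P.force σ₁ i - P.force σ₂ i| ≤ 5 * c₁ * (1 + ρ) ^ (2 * m) * δ := by
  set ℓ := c₁ * (1 + ρ) ^ (2 * m) with hℓ
  have hρ0 : 0 ≤ ρ := (abs_nonneg _).trans (hρ₁ i (by linarith) (by linarith))
  have hℓ0 : 0 ≤ ℓ := by positivity
  -- Lipschitz bounds for `U'` on `[-ρ, ρ]` and `V'` on `[-2ρ, 2ρ]`
  have LU : ∀ x y : ℝ, |x| ≤ ρ → |y| ≤ ρ → |deriv P.U x - deriv P.U y| ≤ ℓ * |x - y| :=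
    fun x y hx hy => abs_deriv_sub_le_of_abs_deriv_two_le hU
      (fun a ha => (hgU a).trans (by rw [hℓ]; gcongr)) hx hy
  have LV : ∀ x y : ℝ, |x| ≤ 2 * ρ → |y| ≤ 2 * ρ →
      |deriv P.V x - deriv P.V y| ≤ ℓ * |x - y| :=
    fun x y hx hy => abs_deriv_sub_le_of_abs_deriv_two_le hV
      (fun a ha => abs_deriv_two_V_le hgV hc₁ a ha) hx hy
  -- the three sites
  have hi0 := hρ₁ i (by linarith) (by linarith)
  have hip := hρ₁ (i + 1) (by linarith) le_rfl
  have him := hρ₁ (i - 1) le_rfl (by linarith)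
  have hi0' := hρ₂ i (by linarith) (by linarith)
  have hip' := hρ₂ (i + 1) (by linarith) le_rfl
  have him' := hρ₂ (i - 1) le_rfl (by linarith)
  have d0 := hδ i (by linarith) (by linarith)
  have dp := hδ (i + 1) (by linarith) le_rfl
  have dm := hδ (i - 1) le_rfl (by linarith)
  have hδ0 : 0 ≤ δ := (abs_nonneg _).trans d0
  have b2 : ∀ {a b : ℝ}, |a| ≤ ρ → |b| ≤ ρ → |b - a| ≤ 2 * ρ := fun ha hb =>
    (abs_sub _ _).trans (by linarith)
  -- term by term
  have t1 : |deriv P.U (σ₁ i).1 - deriv P.U (σ₂ i).1| ≤ ℓ * δ :=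
    (LU _ _ hi0 hi0').trans (mul_le_mul_of_nonneg_left d0 hℓ0)
  have t2 : |deriv P.V ((σ₁ (i + 1)).1 - (σ₁ i).1) - deriv P.V ((σ₂ (i + 1)).1 - (σ₂ i).1)| ≤
      ℓ * (2 * δ) := by
    refine (LV _ _ (b2 hi0 hip) (b2 hi0' hip')).trans (mul_le_mul_of_nonneg_left ?_ hℓ0)
    calc |(σ₁ (i + 1)).1 - (σ₁ i).1 - ((σ₂ (i + 1)).1 - (σ₂ i).1)|
        = |((σ₁ (i + 1)).1 - (σ₂ (i + 1)).1) - ((σ₁ i).1 - (σ₂ i).1)| := by ring_nf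
      _ ≤ |(σ₁ (i + 1)).1 - (σ₂ (i + 1)).1| + |(σ₁ i).1 - (σ₂ i).1| := abs_sub _ _
      _ ≤ δ + δ := add_le_add dp d0
      _ = 2 * δ := by ring
  have t3 : |deriv P.V ((σ₁ i).1 - (σ₁ (i - 1)).1) - deriv P.V ((σ₂ i).1 - (σ₂ (i - 1)).1)| ≤
      ℓ * (2 * δ) := by
    refine (LV _ _ (b2 him hi0) (b2 him' hi0')).trans (mul_le_mul_of_nonneg_left ?_ hℓ0)
    calc |(σ₁ i).1 - (σ₁ (i - 1)).1 - ((σ₂ i).1 - (σ₂ (i - 1)).1)|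
        = |((σ₁ i).1 - (σ₂ i).1) - ((σ₁ (i - 1)).1 - (σ₂ (i - 1)).1)| := by ring_nf
      _ ≤ |(σ₁ i).1 - (σ₂ i).1| + |(σ₁ (i - 1)).1 - (σ₂ (i - 1)).1| := abs_sub _ _
      _ ≤ δ + δ := add_le_add d0 dm
      _ = 2 * δ := by ring
  rw [force_eq, force_eq]
  calc |-deriv P.U (σ₁ i).1 + deriv P.V ((σ₁ (i + 1)).1 - (σ₁ i).1) -
          deriv P.V ((σ₁ i).1 - (σ₁ (i - 1)).1) -
        (-deriv P.U (σ₂ i).1 + deriv P.V ((σ₂ (i + 1)).1 - (σ₂ i).1) -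
          deriv P.V ((σ₂ i).1 - (σ₂ (i - 1)).1))|
      = |-(deriv P.U (σ₁ i).1 - deriv P.U (σ₂ i).1) +
          (deriv P.V ((σ₁ (i + 1)).1 - (σ₁ i).1) - deriv P.V ((σ₂ (i + 1)).1 - (σ₂ i).1)) -
          (deriv P.V ((σ₁ i).1 - (σ₁ (i - 1)).1) - deriv P.V ((σ₂ i).1 - (σ₂ (i - 1)).1))| := by
        ring_nf
    _ ≤ |-(deriv P.U (σ₁ i).1 - deriv P.U (σ₂ i).1) +
          (deriv P.V ((σ₁ (i + 1)).1 - (σ₁ i).1) - deriv P.V ((σ₂ (i + 1)).1 - (σ₂ i).1))| +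
          |deriv P.V ((σ₁ i).1 - (σ₁ (i - 1)).1) - deriv P.V ((σ₂ i).1 - (σ₂ (i - 1)).1)| :=
        abs_sub _ _
    _ ≤ |deriv P.U (σ₁ i).1 - deriv P.U (σ₂ i).1| +
          |deriv P.V ((σ₁ (i + 1)).1 - (σ₁ i).1) - deriv P.V ((σ₂ (i + 1)).1 - (σ₂ i).1)| +
          |deriv P.V ((σ₁ i).1 - (σ₁ (i - 1)).1) - deriv P.V ((σ₂ i).1 - (σ₂ (i - 1)).1)| := by
        gcongr
        exact (abs_add_le _ _).trans (by rw [abs_neg])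
    _ ≤ ℓ * δ + ℓ * (2 * δ) + ℓ * (2 * δ) := add_le_add (add_le_add t1 t2) t3
    _ = 5 * c₁ * (1 + ρ) ^ (2 * m) * δ := by rw [hℓ]; ring

end Lipschitz

/-! ### Elementary real-power bounds -/

/-- `x^{1/m} ≤ x + 1` for `x ≥ 0`, `m ≥ 1`. [folklore] -/
theorem rpow_inv_le_add_one {m : ℕ} (hm : 1 ≤ m) {x : ℝ} (hx : 0 ≤ x) :
    x ^ ((m : ℝ)⁻¹) ≤ x + 1 := by
  have hm1 : (1 : ℝ) ≤ m := by exact_mod_cast hm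
  have hinv0 : 0 ≤ ((m : ℝ)⁻¹) := by positivity
  have hinv1 : ((m : ℝ)⁻¹) ≤ 1 := inv_le_one_of_one_le₀ hm1
  rcases le_total x 1 with h | h
  · exact (Real.rpow_le_one hx h hinv0).trans (by linarith)
  · calc x ^ ((m : ℝ)⁻¹) ≤ x ^ (1 : ℝ) := Real.rpow_le_rpow_of_exponent_le h hinv1
      _ = x := Real.rpow_one x
      _ ≤ x + 1 := by linarith

/-- `((x)^{1/m})^{2m} = x²` for `x ≥ 0`, `m ≥ 1`. [folklore] -/
theorem rpow_inv_pow_two_mul {m : ℕ} (hm : 1 ≤ m) {x : ℝ} (hx : 0 ≤ x) :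
    (x ^ ((m : ℝ)⁻¹)) ^ (2 * m) = x ^ 2 := by
  have hm0 : (m : ℝ) ≠ 0 := by exact_mod_cast (Nat.one_le_iff_ne_zero.mp hm)
  rw [← Real.rpow_natCast, ← Real.rpow_mul hx]
  have : ((m : ℝ)⁻¹) * ((2 * m : ℕ) : ℝ) = ((2 : ℕ) : ℝ) := by push_cast; field_simp
  rw [this, Real.rpow_natCast]

/-! ### Theorem 2 -/

section Thm2

variable {P : OscillatorChain} {m : ℕ} {c₁ C : ℝ}

/-- The uniform local time of uniqueness: for `0 ≤ t ≤ t₀ = 1/(4(K+1))` one has `8 K t² ≤ 1/2`.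
[folklore] -/
theorem eight_mul_sq_le_half {K t : ℝ} (hK : 0 ≤ K) (ht0 : 0 ≤ t) (ht : t ≤ 1 / (4 * (K + 1))) :
    8 * K * t ^ 2 ≤ 1 / 2 := by
  have h1 : t ^ 2 ≤ (1 / (4 * (K + 1))) ^ 2 := pow_le_pow_left₀ ht0 ht 2
  calc 8 * K * t ^ 2 ≤ 8 * K * (1 / (4 * (K + 1))) ^ 2 := by gcongr
    _ = K / (2 * (K + 1) ^ 2) := by field_simp; ring
    _ ≤ 1 / 2 := by
        rw [div_le_iff₀ (by positivity)]
        nlinarith [sq_nonneg K]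

/-- **Local uniqueness (LLL 1977, proof of Thm 2, the `k → ∞` step).** Two global solutions with
the same initial point whose positions obey `|q_j(t)| ≤ C(|j|^{1/m} + 1)` on `[0, τ]` coincide on
`[0, min τ t₀]`, with `t₀ = 1/(4(K+1))`, `K = 5c₁(1+2C)^{2m}`, independent of the solutions. [cite: LanfordLebowitzLieb1977, §3 Thm 2, proof] -/
theorem eqOn_small (hU : ContDiff ℝ 2 P.U) (hV : ContDiff ℝ 2 P.V) (hm : 1 ≤ m) (hc₁ : 0 ≤ c₁)
    (hgU : ∀ a : ℝ, |deriv (deriv P.U) a| ≤ c₁ * (1 + |a|) ^ (2 * m))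
    (hgV : ∀ a b : ℝ, |deriv (deriv P.V) (b - a)| ≤ c₁ * (1 + max |a| |b|) ^ (2 * m))
    (hC : 0 ≤ C) {γ₁ γ₂ : ℝ → ChainConfig} (h₁ : P.IsSolution γ₁) (h₂ : P.IsSolution γ₂)
    (h0 : γ₁ 0 = γ₂ 0) {τ : ℝ}
    (hb₁ : ∀ t ∈ Icc 0 τ, ∀ j : ℤ, |(γ₁ t j).1| ≤ C * (|(j : ℝ)| ^ ((m : ℝ)⁻¹) + 1))
    (hb₂ : ∀ t ∈ Icc 0 τ, ∀ j : ℤ, |(γ₂ t j).1| ≤ C * (|(j : ℝ)| ^ ((m : ℝ)⁻¹) + 1)) :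
    ∀ t ∈ Icc 0 (min τ (1 / (4 * (5 * c₁ * (1 + 2 * C) ^ (2 * m) + 1)))), γ₁ t = γ₂ t := by
  set K := 5 * c₁ * (1 + 2 * C) ^ (2 * m) with hK
  have hK0 : 0 ≤ K := by positivity
  have hm0 : (0 : ℝ) ≤ ((m : ℝ)⁻¹) := by positivity
  -- positions at sites `|j| ≤ N` are bounded by `C (N^{1/m} + 1)`
  have hbox : ∀ {γ : ℝ → ChainConfig},
      (∀ t ∈ Icc 0 τ, ∀ j : ℤ, |(γ t j).1| ≤ C * (|(j : ℝ)| ^ ((m : ℝ)⁻¹) + 1)) →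
      ∀ (N : ℕ) (j : ℤ), |j| ≤ (N : ℤ) → ∀ t ∈ Icc 0 τ,
        |(γ t j).1| ≤ C * ((N : ℝ) ^ ((m : ℝ)⁻¹) + 1) := by
    intro γ hb N j hj t ht
    have hj' : |(j : ℝ)| ≤ N := by exact_mod_cast hj
    calc |(γ t j).1| ≤ C * (|(j : ℝ)| ^ ((m : ℝ)⁻¹) + 1) := hb t ht j
      _ ≤ C * ((N : ℝ) ^ ((m : ℝ)⁻¹) + 1) := by
          gcongr
  -- (12b): the Lipschitz bound with constant `K (n+1)²`
  have hL : ∀ (n : ℕ) (i : ℤ), |i| ≤ (n : ℤ) → ∀ t ∈ Icc 0 τ, ∀ δ : ℝ,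
      (∀ j : ℤ, |j| ≤ (n : ℤ) + 1 → |(γ₁ t j).1 - (γ₂ t j).1| ≤ δ) →
        |P.force (γ₁ t) i - P.force (γ₂ t) i| ≤ K * ((n : ℝ) + 1) ^ 2 * δ := by
    intro n i hi t ht δ hδ
    set ρ : ℝ := C * (((n + 1 : ℕ) : ℝ) ^ ((m : ℝ)⁻¹) + 1) with hρ
    have hin : ∀ j : ℤ, i - 1 ≤ j → j ≤ i + 1 → |j| ≤ ((n + 1 : ℕ) : ℤ) := by
      intro j h1 h2
      have := abs_le.1 hi
      push_cast
      exact abs_le.2 ⟨by omega, by omega⟩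
    have key := force_sub_le hU hV hc₁ hgU hgV (ρ := ρ) (δ := δ) (σ₁ := γ₁ t) (σ₂ := γ₂ t)
      (i := i) (fun j h1 h2 => hbox hb₁ (n + 1) j (hin j h1 h2) t ht)
      (fun j h1 h2 => hbox hb₂ (n + 1) j (hin j h1 h2) t ht)
      (fun j h1 h2 => hδ j (by have := hin j h1 h2; push_cast at this; exact this))
    refine key.trans ?_
    have hδ0 : 0 ≤ δ := (abs_nonneg _).trans (hδ i ((abs_le.1 hi |> fun h => abs_le.2
      ⟨by omega, by omega⟩)))
    -- `(1 + ρ)^{2m} ≤ (1 + 2C)^{2m} (n+1)²`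
    have hx0 : (0 : ℝ) ≤ ((n + 1 : ℕ) : ℝ) := by positivity
    have hx1 : (1 : ℝ) ≤ ((n + 1 : ℕ) : ℝ) ^ ((m : ℝ)⁻¹) :=
      Real.one_le_rpow (by exact_mod_cast Nat.succ_le_succ (Nat.zero_le n)) hm0
    have h1ρ : 1 + ρ ≤ (1 + 2 * C) * ((n + 1 : ℕ) : ℝ) ^ ((m : ℝ)⁻¹) := by
      rw [hρ]; nlinarith [mul_nonneg hC (sub_nonneg.2 hx1)]
    have hpow : (1 + ρ) ^ (2 * m) ≤ (1 + 2 * C) ^ (2 * m) * ((n : ℝ) + 1) ^ 2 := by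
      have hρ0 : 0 ≤ 1 + ρ := by rw [hρ]; positivity
      calc (1 + ρ) ^ (2 * m) ≤ ((1 + 2 * C) * ((n + 1 : ℕ) : ℝ) ^ ((m : ℝ)⁻¹)) ^ (2 * m) :=
            pow_le_pow_left₀ hρ0 h1ρ _
        _ = (1 + 2 * C) ^ (2 * m) * ((n : ℝ) + 1) ^ 2 := by
            rw [mul_pow, rpow_inv_pow_two_mul hm hx0]; push_cast; ring
    calc 5 * c₁ * (1 + ρ) ^ (2 * m) * δ ≤ 5 * c₁ * ((1 + 2 * C) ^ (2 * m) * ((n : ℝ) + 1) ^ 2) * δ := by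
          gcongr
      _ = K * ((n : ℝ) + 1) ^ 2 * δ := by rw [hK]; ring
  -- the starting bound `δ_N ≤ 4C 2^N`
  have hA : ∀ (n : ℕ) (i : ℤ), |i| ≤ (n : ℤ) → ∀ t ∈ Icc 0 τ,
      |(γ₁ t i).1 - (γ₂ t i).1| ≤ 4 * C * 2 ^ n := by
    intro n i hi t ht
    have e1 := hbox hb₁ n i hi t ht
    have e2 := hbox hb₂ n i hi t ht
    have hn : (n : ℝ) ^ ((m : ℝ)⁻¹) + 1 ≤ 2 * 2 ^ n := by
      have h1 := rpow_inv_le_add_one hm (Nat.cast_nonneg n : (0 : ℝ) ≤ n)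
      have h2 : (n : ℝ) + 2 ≤ 2 * 2 ^ n := by
        have : n + 2 ≤ 2 * 2 ^ n := by
          have := Nat.lt_two_pow_self (n := n)
          omega
        exact_mod_cast this
      linarith
    calc |(γ₁ t i).1 - (γ₂ t i).1| ≤ |(γ₁ t i).1| + |(γ₂ t i).1| := abs_sub _ _
      _ ≤ C * ((n : ℝ) ^ ((m : ℝ)⁻¹) + 1) + C * ((n : ℝ) ^ ((m : ℝ)⁻¹) + 1) := add_le_add e1 e2
      _ = 2 * C * ((n : ℝ) ^ ((m : ℝ)⁻¹) + 1) := by ring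
      _ ≤ 2 * C * (2 * 2 ^ n) := by gcongr
      _ = 4 * C * 2 ^ n := by ring
  -- the iteration with LLL's coefficients `Φ(n, k) = 4C 2^{n+k} Kᵏ ((n+k)!)² / ((n!)² (2k)!)`
  have iter := iterate_bound h₁ h₂ h0 hL
    (Φ := fun n k => 4 * C * 2 ^ (n + k) * K ^ k * ((n + k)! : ℝ) ^ 2 /
      ((n ! : ℝ) ^ 2 * ((2 * k)! : ℝ)))
    (fun n i hi t ht => by rw [llCoef_zero]; exact hA n i hi t ht)
    (fun n k => (llCoef_succ (4 * C) K n k).le)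
  -- positions agree on `[0, min τ t₀]`
  have hq : ∀ (i : ℤ), ∀ t ∈ Icc 0 (min τ (1 / (4 * (K + 1)))), (γ₁ t i).1 = (γ₂ t i).1 := by
    intro i t ht
    have htτ : t ∈ Icc 0 τ := ⟨ht.1, ht.2.trans (min_le_left _ _)⟩
    have hsmall : 8 * K * t ^ 2 ≤ 1 / 2 :=
      eight_mul_sq_le_half hK0 ht.1 (ht.2.trans (min_le_right _ _))
    set n := i.natAbs with hn
    have hi : |i| ≤ (n : ℤ) := by rw [hn, Int.natCast_natAbs]
    have hbound : ∀ k : ℕ, |(γ₁ t i).1 - (γ₂ t i).1| ≤ 4 * C * 8 ^ n * (1 / 2) ^ k := by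
      intro k
      calc |(γ₁ t i).1 - (γ₂ t i).1|
          ≤ 4 * C * 2 ^ (n + k) * K ^ k * ((n + k)! : ℝ) ^ 2 / ((n ! : ℝ) ^ 2 * ((2 * k)! : ℝ)) *
              t ^ (2 * k) := iter k n i hi t htτ
        _ ≤ 4 * C * 8 ^ (n + k) * K ^ k * t ^ (2 * k) := by
            gcongr
            · exact pow_nonneg ht.1 _
            · exact llCoef_le (by positivity) hK0 n k
        _ = 4 * C * 8 ^ n * (8 * K * t ^ 2) ^ k := by ring
        _ ≤ 4 * C * 8 ^ n * (1 / 2) ^ k := by gcongr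
    have hlim : Tendsto (fun k : ℕ => 4 * C * 8 ^ n * (1 / 2 : ℝ) ^ k) atTop (𝓝 0) := by
      have h := (tendsto_pow_atTop_nhds_zero_of_lt_one (by norm_num : (0 : ℝ) ≤ 1 / 2)
        (by norm_num : (1 / 2 : ℝ) < 1)).const_mul (4 * C * 8 ^ n)
      simpa using h
    have h0' : |(γ₁ t i).1 - (γ₂ t i).1| ≤ 0 := ge_of_tendsto' hlim hbound
    have := abs_nonpos_iff.1 h0'
    linarith
  -- momenta agree as derivatives of the positions
  intro t ht
  rcases le_or_gt (min τ (1 / (4 * (K + 1)))) 0 with hle | hpos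
  · have : t = 0 := le_antisymm (ht.2.trans hle) ht.1
    rw [this, h0]
  · funext j
    refine Prod.ext (hq j t ht) ?_
    exact deriv_eqOn_of_eqOn hpos (fun s => (h₁ j s).1) (fun s => (h₂ j s).1) (hq j) t ht

/-- **LLL 1977, Theorem 2 on `[0, τ]` (restarting the local step).** Two global solutions with the
same initial point whose positions obey `|q_j(t)| ≤ C(|j|^{1/m} + 1)` on `[0, τ]` coincide on
`[0, τ]`. [cite: LanfordLebowitzLieb1977, §3 Thm 2] -/
theorem eqOn_of_growth (hU : ContDiff ℝ 2 P.U) (hV : ContDiff ℝ 2 P.V) (hm : 1 ≤ m) (hc₁ : 0 ≤ c₁)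
    (hgU : ∀ a : ℝ, |deriv (deriv P.U) a| ≤ c₁ * (1 + |a|) ^ (2 * m))
    (hgV : ∀ a b : ℝ, |deriv (deriv P.V) (b - a)| ≤ c₁ * (1 + max |a| |b|) ^ (2 * m))
    (hC : 0 ≤ C) {γ₁ γ₂ : ℝ → ChainConfig} (h₁ : P.IsSolution γ₁) (h₂ : P.IsSolution γ₂)
    (h0 : γ₁ 0 = γ₂ 0) {τ : ℝ}
    (hb₁ : ∀ t ∈ Icc 0 τ, ∀ j : ℤ, |(γ₁ t j).1| ≤ C * (|(j : ℝ)| ^ ((m : ℝ)⁻¹) + 1))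
    (hb₂ : ∀ t ∈ Icc 0 τ, ∀ j : ℤ, |(γ₂ t j).1| ≤ C * (|(j : ℝ)| ^ ((m : ℝ)⁻¹) + 1)) :
    ∀ t ∈ Icc 0 τ, γ₁ t = γ₂ t := by
  set t₀ : ℝ := 1 / (4 * (5 * c₁ * (1 + 2 * C) ^ (2 * m) + 1)) with ht₀
  have ht₀p : 0 < t₀ := by rw [ht₀]; positivity
  -- by induction on the number of restarts
  have main : ∀ (N : ℕ) (γ₁ γ₂ : ℝ → ChainConfig) (τ : ℝ), P.IsSolution γ₁ → P.IsSolution γ₂ →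
      γ₁ 0 = γ₂ 0 →
      (∀ t ∈ Icc 0 τ, ∀ j : ℤ, |(γ₁ t j).1| ≤ C * (|(j : ℝ)| ^ ((m : ℝ)⁻¹) + 1)) →
      (∀ t ∈ Icc 0 τ, ∀ j : ℤ, |(γ₂ t j).1| ≤ C * (|(j : ℝ)| ^ ((m : ℝ)⁻¹) + 1)) →
      ∀ t ∈ Icc 0 (min τ (N * t₀)), γ₁ t = γ₂ t := by
    intro N
    induction N with
    | zero =>
      intro γ₁ γ₂ τ _ _ h0 _ _ t ht
      have : t = 0 := le_antisymm (ht.2.trans ((min_le_right _ _).trans (by simp))) ht.1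
      rw [this, h0]
    | succ N ih =>
      intro γ₁ γ₂ τ h₁ h₂ h0 hb₁ hb₂ t ht
      have loc := eqOn_small hU hV hm hc₁ hgU hgV hC h₁ h₂ h0 hb₁ hb₂
      by_cases hle : t ≤ t₀
      · exact loc t ⟨ht.1, le_min (ht.2.trans (min_le_left _ _)) hle⟩
      · have hlt : t₀ < t := not_le.mp hle
        have htτ : t ≤ τ := ht.2.trans (min_le_left _ _)
        have hτ : t₀ ≤ τ := hlt.le.trans htτ
        have e0 : γ₁ t₀ = γ₂ t₀ := loc t₀ ⟨ht₀p.le, le_min hτ le_rfl⟩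
        have hs : ∀ {γ : ℝ → ChainConfig},
            (∀ t ∈ Icc 0 τ, ∀ j : ℤ, |(γ t j).1| ≤ C * (|(j : ℝ)| ^ ((m : ℝ)⁻¹) + 1)) →
            ∀ s ∈ Icc 0 (τ - t₀), ∀ j : ℤ,
              |((fun u => γ (u + t₀)) s j).1| ≤ C * (|(j : ℝ)| ^ ((m : ℝ)⁻¹) + 1) :=
          fun hb s hs j => hb (s + t₀) ⟨by linarith [hs.1], by linarith [hs.2]⟩ j
        have ht' : t - t₀ ≤ (N : ℝ) * t₀ := by
          have h := ht.2.trans (min_le_right _ _)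
          push_cast at h
          linarith
        have key := ih (fun u => γ₁ (u + t₀)) (fun u => γ₂ (u + t₀)) (τ - t₀)
          (h₁.comp_add_const t₀) (h₂.comp_add_const t₀) (by simpa using e0) (hs hb₁) (hs hb₂)
          (t - t₀) ⟨by linarith, le_min (by linarith) ht'⟩
        simpa using key
  intro t ht
  obtain ⟨N, hN⟩ : ∃ N : ℕ, τ ≤ N * t₀ := by
    obtain ⟨N, hN⟩ := exists_nat_ge (τ / t₀)
    exact ⟨N, by rw [div_le_iff₀ ht₀p] at hN; exact hN⟩
  exact main N γ₁ γ₂ τ h₁ h₂ h0 hb₁ hb₂ t ⟨ht.1, le_min ht.2 (ht.2.trans hN)⟩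

/-- **Lanford–Lebowitz–Lieb 1977, Theorem 2 with the Example (13), for the chain — proved.**
Discharges the named fact `LanfordLebowitzLieb1977_thm2_chain`: under A₂ and (13) with
`n = m + 1 ≥ 2`, two global solutions from the same initial point, both in the growth class
`sup_{|t| ≤ τ} sup_j |q_j(t)|/(|j|^{1/m} + 1) < ∞ ∀ τ`, agree for all `t ≥ 0`. Proof as printed
(§3, p. 457–458): the iteration `iterate_bound`, the `k → ∞` step `eqOn_small`, restarted along
`[0, t]` (`eqOn_of_growth`). [cite: LanfordLebowitzLieb1977, §3 Thm 2 and Example (13)] -/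
theorem LanfordLebowitzLieb1977_thm2_chain_holds : LanfordLebowitzLieb1977_thm2_chain := by
  intro P hU hV m hm hgr γ₁ γ₂ h₁ h₂ h0 hG₁ hG₂ t ht
  obtain ⟨c₁, hgU, hgV⟩ := hgr
  have hc₁ : 0 ≤ c₁ := (abs_nonneg _).trans (by simpa using hgU 0)
  obtain ⟨C₁, hC₁⟩ := hG₁ t
  obtain ⟨C₂, hC₂⟩ := hG₂ t
  set C := max (max C₁ C₂) 0 with hCdef
  have hC : 0 ≤ C := le_max_right _ _
  have hb : ∀ {γ : ℝ → ChainConfig} {C' : ℝ}, C' ≤ C →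
      (∀ s : ℝ, |s| ≤ t → ∀ j : ℤ, |(γ s j).1| ≤ C' * (|(j : ℝ)| ^ ((m : ℝ)⁻¹) + 1)) →
      ∀ s ∈ Icc 0 t, ∀ j : ℤ, |(γ s j).1| ≤ C * (|(j : ℝ)| ^ ((m : ℝ)⁻¹) + 1) := by
    intro γ C' hC' h s hs j
    have hs' : |s| ≤ t := by rw [abs_of_nonneg hs.1]; exact hs.2
    exact (h s hs' j).trans (mul_le_mul_of_nonneg_right hC' (by positivity))
  exact eqOn_of_growth hU hV hm hc₁ hgU hgV hC h₁ h₂ h0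
    (hb ((le_max_left _ _).trans (le_max_left _ _)) hC₁)
    (hb ((le_max_right _ _).trans (le_max_left _ _)) hC₂) t ⟨ht, le_rfl⟩

end Thm2

/-! ### Theorem 4: uniqueness for all times, by time reversal -/

section Thm4

variable {P : OscillatorChain}

/-- The force depends on the positions only. [folklore] -/
theorem force_congr_fst {σ σ' : ChainConfig} (h : ∀ j, (σ j).1 = (σ' j).1) (i : ℤ) :
    P.force σ i = P.force σ' i := by
  simp only [force_eq, h]

/-- **Time reversal.** If `γ` solves (1a)–(1b), so does `t ↦ (q(-t), -p(-t))`. [folklore] -/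
theorem IsSolution.timeRev {γ : ℝ → ChainConfig} (hγ : P.IsSolution γ) :
    P.IsSolution fun t j => ((γ (-t) j).1, -(γ (-t) j).2) := by
  intro i t
  obtain ⟨h1, h2⟩ := hγ i (-t)
  refine ⟨?_, ?_⟩
  · have h : HasDerivAt (fun s => (γ (-s) i).1) ((γ (-t) i).2 * -1) t :=
      h1.comp t (hasDerivAt_neg t)
    simpa using h
  · have h : HasDerivAt (fun s => -(γ (-s) i).2) (-(P.force (γ (-t)) i * -1)) t :=
      (h2.comp t (hasDerivAt_neg t)).neg
    have hF : P.force (γ (-t)) i = P.force (fun j => ((γ (-t) j).1, -(γ (-t) j).2)) i :=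
      force_congr_fst (fun j => rfl) i
    simpa [hF] using h

/-- The growth class is invariant under time reversal. [folklore] -/
theorem inGrowthClass_timeRev {m : ℕ} {γ : ℝ → ChainConfig} (h : InGrowthClass m γ) :
    InGrowthClass m fun t j => ((γ (-t) j).1, -(γ (-t) j).2) := by
  intro τ
  obtain ⟨C, hC⟩ := h τ
  exact ⟨C, fun t ht j => by simpa using hC (-t) (by simpa using ht) j⟩

/-- **Uniqueness for all times from Theorem 2.** Under A₂ and (13) with `n = m + 1 ≥ 2`, two
global solutions in the growth class with the same initial point coincide: Theorem 2 forward in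
time, and Theorem 2 applied to the time-reversed solutions backward in time ("Theorem 2 asserts
that the solution is unique in this class"). [cite: LanfordLebowitzLieb1977, §3 Thm 2 and §4 Thm 4] -/
theorem eq_of_inGrowthClass (hU : ContDiff ℝ 2 P.U) (hV : ContDiff ℝ 2 P.V) {m : ℕ} (hm : 1 ≤ m)
    (hgr : P.HasForceGrowth m) {γ₁ γ₂ : ℝ → ChainConfig} (h₁ : P.IsSolution γ₁)
    (h₂ : P.IsSolution γ₂) (h0 : γ₁ 0 = γ₂ 0) (hG₁ : InGrowthClass m γ₁)
    (hG₂ : InGrowthClass m γ₂) : γ₁ = γ₂ := by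
  funext t
  rcases le_total 0 t with ht | ht
  · exact LanfordLebowitzLieb1977_thm2_chain_holds P hU hV m hm hgr γ₁ γ₂ h₁ h₂ h0 hG₁ hG₂ t ht
  · have key := LanfordLebowitzLieb1977_thm2_chain_holds P hU hV m hm hgr _ _ h₁.timeRev
      h₂.timeRev (by simp only [neg_zero, h0]) (inGrowthClass_timeRev hG₁)
      (inGrowthClass_timeRev hG₂) (-t) (by linarith)
    funext j
    have kj := congrFun key j
    simp only [neg_neg, Prod.mk.injEq, neg_inj] at kj
    exact Prod.ext kj.1 kj.2

/-! ### Theorem 4: the Borel–Cantelli Proposition ((18) ⇒ (17)) -/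

/-- **LLL 1977, §4 Proposition ((18) ⇒ (17)), chain instance (`ν = 1`, `n - 1 = m`).** If
`∫ |q_i|^γ dμ ≤ C` for all `i` with `γ > m`, then `μ`-a.e. `sup_i |q_i| / (|i|^{1/m} + 1) < ∞`.
Printed proof: "Since `γ/(n-1) > ν`, `∑_i μ{|q_i| > |i|^{1/(n-1)}} ≤ C ∑_i |i|^{-γ/(n-1)} < ∞`, so by
the Borel–Cantelli lemma `limsup_i (|q_i|/|i|^{1/(n-1)}) ≤ 1` `μ` almost everywhere" (here with
the thresholds `(|i|+1)^{1/m} ≤ |i|^{1/m} + 1` and Markov's inequality). [cite: LanfordLebowitzLieb1977, §4 Proposition, pp. 460–461] -/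
theorem ae_growth_of_moment (μ : Measure ChainConfig) {m : ℕ} (hm : 1 ≤ m) {γ : ℝ}
    (hγ : (m : ℝ) < γ) {C : ℝ}
    (hC : ∀ i : ℤ, ∫⁻ σ, ENNReal.ofReal (|(σ i).1| ^ γ) ∂μ ≤ ENNReal.ofReal C) :
    ∀ᵐ σ ∂μ, ∃ C' : ℝ, ∀ i : ℤ, |(σ i).1| ≤ C' * (|(i : ℝ)| ^ ((m : ℝ)⁻¹) + 1) := by
  have hm0 : (0 : ℝ) < m := by exact_mod_cast hm
  have hγ0 : 0 < γ := hm0.trans hγ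
  have hmi : (0 : ℝ) < ((m : ℝ)⁻¹) := by positivity
  -- the exponent `p = γ/m > 1`
  set p : ℝ := γ / m with hp
  have hp1 : 1 < p := by rw [hp, lt_div_iff₀ hm0]; simpa using hγ
  -- thresholds `T_i = (|i| + 1)^{1/m}`
  have hT0 : ∀ i : ℤ, 0 < (|(i : ℝ)| + 1) ^ ((m : ℝ)⁻¹) := fun i => by positivity
  have hTγ : ∀ i : ℤ, ((|(i : ℝ)| + 1) ^ ((m : ℝ)⁻¹)) ^ γ = (|(i : ℝ)| + 1) ^ p := fun i => by
    rw [← Real.rpow_mul (by positivity), inv_mul_eq_div]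
  set C' := max C 0 with hC'
  -- Markov: `μ(|q_i| > T_i) ≤ C' (|i|+1)^{-p}`
  have hμs : ∀ i : ℤ, μ {σ | (|(i : ℝ)| + 1) ^ ((m : ℝ)⁻¹) < |(σ i).1|} ≤
      ENNReal.ofReal (C' * (|(i : ℝ)| + 1) ^ (-p)) := by
    intro i
    have hf : Measurable (fun σ : ChainConfig => ENNReal.ofReal (|(σ i).1| ^ γ)) :=
      ((continuous_abs.measurable.comp (measurable_pi_apply i).fst).pow_const γ).ennreal_ofReal
    have hmarkov := mul_meas_ge_le_lintegral₀ (μ := μ) hf.aemeasurable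
      (ENNReal.ofReal (((|(i : ℝ)| + 1) ^ ((m : ℝ)⁻¹)) ^ γ))
    have hsub : {σ : ChainConfig | (|(i : ℝ)| + 1) ^ ((m : ℝ)⁻¹) < |(σ i).1|} ⊆
        {σ | ENNReal.ofReal (((|(i : ℝ)| + 1) ^ ((m : ℝ)⁻¹)) ^ γ) ≤
          ENNReal.ofReal (|(σ i).1| ^ γ)} := by
      intro σ hσ
      exact ENNReal.ofReal_le_ofReal (Real.rpow_le_rpow (hT0 i).le (le_of_lt hσ) hγ0.le)
    have hTγ0 : 0 < ((|(i : ℝ)| + 1) ^ ((m : ℝ)⁻¹)) ^ γ := Real.rpow_pos_of_pos (hT0 i) γ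
    have hpos : ENNReal.ofReal (((|(i : ℝ)| + 1) ^ ((m : ℝ)⁻¹)) ^ γ) ≠ 0 := by
      rw [Ne, ENNReal.ofReal_eq_zero, not_le]; exact hTγ0
    calc μ {σ | (|(i : ℝ)| + 1) ^ ((m : ℝ)⁻¹) < |(σ i).1|}
        ≤ μ {σ | ENNReal.ofReal (((|(i : ℝ)| + 1) ^ ((m : ℝ)⁻¹)) ^ γ) ≤
            ENNReal.ofReal (|(σ i).1| ^ γ)} := measure_mono hsub
      _ ≤ (∫⁻ σ, ENNReal.ofReal (|(σ i).1| ^ γ) ∂μ) /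
            ENNReal.ofReal (((|(i : ℝ)| + 1) ^ ((m : ℝ)⁻¹)) ^ γ) := by
          rw [ENNReal.le_div_iff_mul_le (Or.inl hpos) (Or.inl ENNReal.ofReal_ne_top), mul_comm]
          exact hmarkov
      _ ≤ ENNReal.ofReal C' / ENNReal.ofReal (((|(i : ℝ)| + 1) ^ ((m : ℝ)⁻¹)) ^ γ) := by
          gcongr
          exact (hC i).trans (ENNReal.ofReal_le_ofReal (le_max_left _ _))
      _ = ENNReal.ofReal (C' * (|(i : ℝ)| + 1) ^ (-p)) := by
          rw [← ENNReal.ofReal_div_of_pos hTγ0, hTγ, Real.rpow_neg (by positivity),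
            div_eq_mul_inv]
  -- `∑_i C' (|i|+1)^{-p} < ∞`
  have hsum : Summable fun i : ℤ => C' * (|(i : ℝ)| + 1) ^ (-p) := by
    apply Summable.mul_left
    have hnat : Summable fun n : ℕ => ((n : ℝ) + 1) ^ (-p) := by
      have h := (summable_nat_add_iff 1).mpr (Real.summable_nat_rpow_inv.mpr hp1)
      refine h.congr fun n => ?_
      push_cast
      rw [Real.rpow_neg (by positivity)]
    refine Summable.of_nat_of_neg ?_ ?_
    · simpa using hnat
    · simpa using hnat
  have hne : ∑' i : ℤ, μ {σ | (|(i : ℝ)| + 1) ^ ((m : ℝ)⁻¹) < |(σ i).1|} ≠ ∞ := by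
    have h1 : ∑' i : ℤ, μ {σ | (|(i : ℝ)| + 1) ^ ((m : ℝ)⁻¹) < |(σ i).1|} ≤
        ∑' i : ℤ, ENNReal.ofReal (C' * (|(i : ℝ)| + 1) ^ (-p)) := ENNReal.tsum_le_tsum hμs
    have h2 : ∑' i : ℤ, ENNReal.ofReal (C' * (|(i : ℝ)| + 1) ^ (-p)) =
        ENNReal.ofReal (∑' i : ℤ, C' * (|(i : ℝ)| + 1) ^ (-p)) :=
      (ENNReal.ofReal_tsum_of_nonneg (fun i => by positivity) hsum).symm
    exact ne_top_of_le_ne_top (by rw [h2]; exact ENNReal.ofReal_ne_top) h1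
  -- Borel–Cantelli: a.e. only finitely many thresholds are exceeded
  filter_upwards [ae_finite_setOf_mem hne] with σ hσ
  refine ⟨1 + ∑ j ∈ hσ.toFinset, |(σ j).1|, fun i => ?_⟩
  have hS : 0 ≤ ∑ j ∈ hσ.toFinset, |(σ j).1| := Finset.sum_nonneg fun j _ => abs_nonneg _
  have hri : 0 ≤ |(i : ℝ)| ^ ((m : ℝ)⁻¹) := by positivity
  by_cases hi : (|(i : ℝ)| + 1) ^ ((m : ℝ)⁻¹) < |(σ i).1|
  · have hmem : i ∈ hσ.toFinset := hσ.mem_toFinset.mpr hi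
    have hle : |(σ i).1| ≤ ∑ j ∈ hσ.toFinset, |(σ j).1| :=
      Finset.single_le_sum (f := fun j => |(σ j).1|) (fun j _ => abs_nonneg _) hmem
    nlinarith
  · have hle : |(σ i).1| ≤ (|(i : ℝ)| + 1) ^ ((m : ℝ)⁻¹) := not_lt.mp hi
    have hT' : (|(i : ℝ)| + 1) ^ ((m : ℝ)⁻¹) ≤ |(i : ℝ)| ^ ((m : ℝ)⁻¹) + 1 := by
      calc (|(i : ℝ)| + 1) ^ ((m : ℝ)⁻¹) ≤ |(i : ℝ)| ^ ((m : ℝ)⁻¹) + (1 : ℝ) ^ ((m : ℝ)⁻¹) :=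
            Real.rpow_add_le_add_rpow (abs_nonneg _) zero_le_one hmi.le
              (inv_le_one_of_one_le₀ (by exact_mod_cast hm))
        _ = |(i : ℝ)| ^ ((m : ℝ)⁻¹) + 1 := by rw [Real.one_rpow]
    nlinarith

/-! ### Theorem 4: assembly -/

/-- `[log₊ x]^{1/2} ≤ m (x^{1/m} + 1)` for `x ≥ 0`, `m ≥ 1` (`log x ≤ m x^{1/m}`). [folklore] -/
theorem sqrt_logPlus_le {m : ℕ} (hm : 1 ≤ m) {x : ℝ} (hx : 0 ≤ x) :
    Real.sqrt (max (Real.log x) 1) ≤ m * (x ^ ((m : ℝ)⁻¹) + 1) := by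
  have hm1 : (1 : ℝ) ≤ m := by exact_mod_cast hm
  have hr : 0 ≤ x ^ ((m : ℝ)⁻¹) := by positivity
  have h1 : 1 ≤ max (Real.log x) 1 := le_max_right _ _
  have hlog : Real.log x ≤ m * x ^ ((m : ℝ)⁻¹) := by
    have h := Real.log_le_rpow_div hx (by positivity : (0 : ℝ) < (m : ℝ)⁻¹)
    rwa [div_inv_eq_mul, mul_comm] at h
  have h2 : max (Real.log x) 1 ≤ m * (x ^ ((m : ℝ)⁻¹) + 1) :=
    max_le (by nlinarith) (by nlinarith)
  have h3 : Real.sqrt (max (Real.log x) 1) ≤ max (Real.log x) 1 := by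
    have h0 : 0 ≤ max (Real.log x) 1 := by linarith
    calc Real.sqrt (max (Real.log x) 1) ≤ Real.sqrt ((max (Real.log x) 1) ^ 2) :=
          Real.sqrt_le_sqrt (by nlinarith)
      _ = max (Real.log x) 1 := Real.sqrt_sq h0
  exact h3.trans h2

/-- **From (15) and (17) to the growth class** ("if `{q_i, p_i}` satisfies (17) and if there exists
a solution to (3) satisfying (15), then `sup_{|t| ≤ τ} sup_i [|q_i(t)|/|i|^{1/(n-1)}]` is finite
for all `τ`"). [cite: LanfordLebowitzLieb1977, §4, p. 460] -/
theorem inGrowthClass_of_thm3_bound {m : ℕ} (hm : 1 ≤ m) {σ : ChainConfig} {C' : ℝ}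
    (hσ : ∀ i : ℤ, |(σ i).1| ≤ C' * (|(i : ℝ)| ^ ((m : ℝ)⁻¹) + 1)) {γ : ℝ → ChainConfig} {C : ℝ}
    (hγ : ∀ (t : ℝ) (i : ℤ),
      |(γ t i).1 - (σ i).1| ≤ C * (1 + t ^ 2) * Real.sqrt (max (Real.log |(i : ℝ)|) 1)) :
    InGrowthClass m γ := by
  intro τ
  refine ⟨C' + |C| * (1 + τ ^ 2) * m, fun t ht i => ?_⟩
  have hr : 0 ≤ |(i : ℝ)| ^ ((m : ℝ)⁻¹) := by positivity
  have hsq := sqrt_logPlus_le hm (abs_nonneg (i : ℝ))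
  have hs0 : 0 ≤ Real.sqrt (max (Real.log |(i : ℝ)|) 1) := Real.sqrt_nonneg _
  have ht2 : t ^ 2 ≤ τ ^ 2 := sq_le_sq.mpr (ht.trans (le_abs_self τ))
  have h1 : |(γ t i).1 - (σ i).1| ≤ |C| * (1 + τ ^ 2) * (m * (|(i : ℝ)| ^ ((m : ℝ)⁻¹) + 1)) :=
    calc |(γ t i).1 - (σ i).1| ≤ C * (1 + t ^ 2) * Real.sqrt (max (Real.log |(i : ℝ)|) 1) :=
          hγ t i
      _ ≤ |C| * (1 + t ^ 2) * Real.sqrt (max (Real.log |(i : ℝ)|) 1) := by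
          gcongr; exact le_abs_self C
      _ ≤ |C| * (1 + τ ^ 2) * (m * (|(i : ℝ)| ^ ((m : ℝ)⁻¹) + 1)) := by gcongr
  calc |(γ t i).1| = |(σ i).1 + ((γ t i).1 - (σ i).1)| := by ring_nf
    _ ≤ |(σ i).1| + |(γ t i).1 - (σ i).1| := abs_add_le _ _
    _ ≤ C' * (|(i : ℝ)| ^ ((m : ℝ)⁻¹) + 1) +
          |C| * (1 + τ ^ 2) * (m * (|(i : ℝ)| ^ ((m : ℝ)⁻¹) + 1)) := add_le_add (hσ i) h1
    _ = (C' + |C| * (1 + τ ^ 2) * m) * (|(i : ℝ)| ^ ((m : ℝ)⁻¹) + 1) := by ring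

/-- **Lanford–Lebowitz–Lieb 1977, Theorem 4, for the nearest-neighbour chain — proved.**
Discharges the named fact `LanfordLebowitzLieb1977_thm4_chain`: under A₁, A₂ (`U, V ∈ C²`), B₁,
B₂ and (13) with `n = m + 1 > 1`, for a Gibbs state `μ` with `∫ |q_i|^γ dμ ≤ C`, `γ > m`, for
`μ`-a.e. initial point there is a solution of the equations of motion in the growth class
`sup_{|t| ≤ τ} sup_i |q_i(t)|/(|i|^{1/m} + 1) < ∞ ∀ τ`, unique among such solutions. Proof as
printed (§4, pp. 460–461, "Collecting the above results"): Theorem 3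
(`LanfordLebowitzLieb1977_thm3_chain_holds`) gives a.e. a solution with (15); the Proposition
(`ae_growth_of_moment`) gives (17) a.e.; (15) + (17) put the solution in the growth class
(`inGrowthClass_of_thm3_bound`); Theorem 2 (`LanfordLebowitzLieb1977_thm2_chain_holds`, with time
reversal, `eq_of_inGrowthClass`) gives uniqueness. [cite: LanfordLebowitzLieb1977, §4 Thm 4] -/
theorem LanfordLebowitzLieb1977_thm4_chain_holds : LanfordLebowitzLieb1977_thm4_chain := by
  intro P T hT hU hV hB1 hB2 m hm hgr μ hμ hmom
  obtain ⟨γ, hγ, C, hC⟩ := hmom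
  have h3 := LanfordLebowitzLieb1977_thm3_chain_holds P T hT hU hV hB1 hB2 μ hμ
  have h17 := ae_growth_of_moment μ hm hγ hC
  filter_upwards [h3, h17] with σ h3σ h17σ
  obtain ⟨γs, h0, hsol, C₃, hb⟩ := h3σ
  obtain ⟨C', hC'⟩ := h17σ
  have hG : InGrowthClass m γs := inGrowthClass_of_thm3_bound hm hC' hb
  exact ⟨γs, h0, hsol, hG, fun γ' h0' hsol' hG' =>
    eq_of_inGrowthClass hU hV hm hgr hsol' hsol (h0'.trans h0.symm) hG' hG⟩

end Thm4


end OscillatorChain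

end Literature.MathematicalPhysics.KineticTheory.HeatConduction

end
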